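import Summits.NavierStokesRegularity.NavierStokesRegularity.Theorems.ArgmaxDoorsAncient
import Summits.NavierStokesRegularity.NavierStokesRegularity.Theorems.StrainDoorsAlmostCompositions
import Summits.NavierStokesRegularity.NavierStokesRegularity.Theorems.StrainDoorsGrowthWeighted
import Summits.NavierStokesRegularity.NavierStokesRegularity.Theorems.StrainDoorsThresholdAncient
import Summits.NavierStokesRegularity.NavierStokesRegularity.Theorems.StrainClockRigid
import HarnessLib
import HarnessLib

/-!
# StrainClockDoorsDefs — door family S38 «StrainClockDoors»: texts of record (§0–§4)

P0-38 part 1 of 4: §0–§4 (`strainRateOn`, `strainRate_eq_strainRateOn`, `strainQuad_le_opNorm`; doors `StrainRatioDoor`, `StrainClockNoStretching`, `StrainClockLiouville`, `TypeIAncientSubcriticalStrain`, `TypeIAncientStrainLaw`, `TypeIAncientStrainLiouville`; plates `StrainFrameOn`, `StrainThresholdOn`, `RigidMotion`) of nsreg-p1 g32's `r36/Sketch38.lean` sha16 a4b540f36e6f6589 (ROUND-36 acb2d0e710b3adcc; PLATE-AID-38 §3),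
every declaration byte-identical, order preserved; landed by ns-s29-p2 g4 on LEAD ns-s30-p1 g3's key 2026-08-28T20:16:56Z (g),
`--supports stmt-NavierStokesRegularity-0056 --as helper`.  `--kind definition`.
The sketch's module docstring follows verbatim.

HONEST FRAME: door family S38 «StrainClockDoors» = the strain-clock criteria (forward door A0 «StrainRatioDoor»; ANCIENT /
Type-I-ancient rate-free Liouville-type doors A1/A2) about HYPOTHETICAL blow-up profiles; items 0056 `NoTypeII`, 10661 and NS
regularity are NOT proved; nothing here is a route or a summit statement.
-/


/-!
# Sketch38 — door family S38 «StrainClockDoors» (nsreg-p1 g32, ROUND-36): texts of record + kernel-checked compositions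

The S37 strain-argmax Riccati engine (`∂ₜ⟪∇u ē,ē⟫ ≤ −Λ² + H` at a (penalised, almost) maximiser `(x̄,ē)` of the
strain form, `H = ¼(|ω|² − ⟪ω,ē⟫²) − ∇²p(ē,ē)` — plate E1_S♭ `ArgmaxDoors.strainGrowthWeighted`, p660752) taken to
the LIOUVILLE WALL: bounded ANCIENT classical solutions on `(−∞,0) × ℝ³` (the Koch–Nadirashvili–Seregin–Šverák
class; frame binders copied from LEAD ns-s30-p1 g3's `ArgmaxDoorsAncient`). NEW LEVER: the Riccati credit `−Λ²` is
ITS OWN CLOCK. If at the charged strain almost-maximisers the feed is a fixed fraction of the square of the top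
strain eigenvalue, `H ≤ c·⟪∇u ē,ē⟫²` with `c < 1`, then `d(1/Λ)/ds ≥ κ := 1 − c`, so on a backward slab `[s₁,s₂]`
the comparison function `B(s) = 1/(1/L + κ(s − s₁))` (`B' = −κB²`, `B(s₁) = L ≥ Λ(s₁)`) dominates `Λ`, and
`Λ(s₂) ≤ 1/(κ(s₂ − s₁)) → 0` as `s₁ → −∞`: an ancient solution with bounded gradient has NO STRETCHING DIRECTION at
all (`⟪∇u e,e⟫ ≤ 0` everywhere, hence `S ≡ 0` by `tr S = div u = 0`), and a bounded field with `S ≡ 0` is constant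
(plate «RigidMotion»). No blow-up time, no `(T − t)`-weight, no Type-I rate enters: the hypothesis is a pure RATIO
at one point per time (door A1 «StrainClockLiouville»). Its Type-I twin (door A2 «TypeIAncientStrainLaw») charges
the dimensionless feed `(−s)²H ≤ c < y₀(1+y₀)` above the line `(−s)⟪∇u ē,ē⟫ > y₀` exactly as S37-H♭ does forward,
runs the S37 LOG BARRIER from `s₁ → −∞` (the clock origin is the END `s = 0` of the ancient interval, so the barrier
is tuned to land at `y₀/(−s₀)` at any prescribed `s₀ < 0`), gets `(−s)Λ(s) ≤ y₀ < 1` for all `s < 0`, hence the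
rate hypothesis `α − ν|∇ξ|² ≤ ⟪∇u ξ,ξ⟫ ≤ y₀/(−s)` of LEAD's landed ancient vorticity law
`ArgmaxDoors.curl_eq_zero_of_ancient_typeI_of_almostArgmax_rate` at EVERY point, so `ω ≡ 0` and `u(s,·)` is
constant BY NAME. The forward face (door A0 «StrainRatioDoor») is PROVED outright here over landed S37 machinery:
in a putative blow-up the feed must reach `(1 − o(1))·Λ²` recurrently at the charged strain almost-maximisers
(FEEDING PARITY; restricted Euler sits at `H/Λ² ≡ 2`).

* §0 `strainRateOn`, `strainQuad_le_opNorm` · §1 door A0 «StrainRatioDoor» (forward; PROVED `strainRatioDoor_holds`)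
* §2 doors A1 «StrainClockNoStretching» / «StrainClockLiouville» (ancient, rate-free)
* §3 doors A2 «TypeIAncientSubcriticalStrain» / «TypeIAncientStrainLaw» / «TypeIAncientStrainLiouville» (ancient, Type-I)
* §4 plates F_S∘ «StrainFrameOn» (S; PROVED here), E2_S∘ «StrainThresholdOn» (S; the NS instance of the device
  p657155 on a CLOSED slab with a bounded gradient instead of the Sobolev class; CLOSED BY NAME = LEAD's p661976
  `ArgmaxDoors.strainThresholdAncient`), «RigidMotion» (S; bounded Killing fields of `ℝ³` are constant — the shape
  of ns-sfl-p1 g5's LANDED p663033 `ArgmaxDoors.eq_of_strain_eq_zero_of_bounded`, CLOSED BY NAME in §6; the TRACE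
  STEP `≤ 0 ⇒ = 0` via `div u = 0` is PROVED here, §5)
* §5 compositions: `strainClockNoStretching_of : StrainFrameOn → StrainThresholdOn → StrainClockNoStretching`,
  `strainClockLiouville_of : StrainClockNoStretching → RigidMotion → StrainClockLiouville`,
  `typeIAncientSubcriticalStrain_of : StrainFrameOn → StrainThresholdOn → TypeIAncientSubcriticalStrain`,
  `typeIAncientStrainLaw_of : TypeIAncientSubcriticalStrain → TypeIAncientStrainLaw` (LEAD's law BY NAME),
  `typeIAncientStrainLiouville_of`; §6 the plate closers and `_holds` corollaries (EVERY door closes OUTRIGHT: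
  A0, A1♮, A1, A2♮, A2, A2♯ — no hypothesis, standard axioms).

HONEST LABEL: CONDITIONAL LIOUVILLE THEOREMS for bounded ancient solutions (director #241 framing: hard core H2
10661 `TypeIliouvilleL` / W3 is FACED by name as the conclusion, under a one-point strain-feed hypothesis; it is NOT
proved) and one forward regularity CRITERION (A0). WHAT THIS IS NOT: item 0056 `NoTypeII`, item 10661 and NS
regularity are NOT proved; no Literature fact is a hypothesis; nothing here is a route or a summit statement
(`--supports stmt-NavierStokesRegularity-0056 --as helper`, Theorems-only landings by the S-lane).
-/

noncomputable section

open MeasureTheory Set Function Filter Metric Real InnerProductSpace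
open _root_.Topology
open scoped ENNReal NNReal RealInnerProductSpace ContDiff Laplacian
open Literature.Analysis Literature.Analysis.FluidPDE
open Literature.Analysis.FluidPDE.VorticityDirectionDynamics

set_option linter.dupNamespace false

namespace Summit.NavierStokesRegularity.NavierStokesRegularity.Theorems.StrainDoors

open Summit.NavierStokesRegularity.NavierStokesRegularity.Theorems.ArgmaxDoors

-- nested operator types (second derivatives)
set_option maxSynthPendingDepth 3
/-! ## §0 One-point quantities on a general time set -/

/-- support (definition): the one-sided TIME DERIVATIVE of the strain form at fixed `(x,e)` within a time set `S`
(`strainRate T = strainRateOn (Ico 0 T)` by `rfl`; on backward slabs `S = Icc s₁ s₂`):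
`⟪∂ₜ(∇u e)(s,x), e⟫`, `∂ₜ = timeDerivWithin S` applied to the field `(r,y) ↦ ∇u(r,y) e`. -/
def strainRateOn (S : Set ℝ) (u : ℝ → (EuclideanSpace ℝ (Fin 3)) → (EuclideanSpace ℝ (Fin 3))) (s : ℝ)
    (x e : EuclideanSpace ℝ (Fin 3)) : ℝ :=
  ⟪timeDerivWithin S (fun r y => fderiv ℝ (u r) y e) s x, e⟫

/-- `strainRate T` is `strainRateOn [0,T)`. [folklore] -/
theorem strainRate_eq_strainRateOn (T : ℝ) (u : ℝ → (EuclideanSpace ℝ (Fin 3)) → (EuclideanSpace ℝ (Fin 3)))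
    (t : ℝ) (x e : EuclideanSpace ℝ (Fin 3)) : strainRate T u t x e = strainRateOn (Ico 0 T) u t x e := rfl

/-- The strain form along a unit vector is bounded by the operator norm of the gradient. [folklore] -/
theorem strainQuad_le_opNorm (u : ℝ → (EuclideanSpace ℝ (Fin 3)) → (EuclideanSpace ℝ (Fin 3))) (t : ℝ)
    (x : EuclideanSpace ℝ (Fin 3)) {e : EuclideanSpace ℝ (Fin 3)} (he : ‖e‖ = 1) :
    strainQuad u t x e ≤ ‖fderiv ℝ (u t) x‖ := by
  calc strainQuad u t x e ≤ ‖fderiv ℝ (u t) x e‖ * ‖e‖ := real_inner_le_norm _ _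
    _ ≤ ‖fderiv ℝ (u t) x‖ * ‖e‖ * ‖e‖ := by
        gcongr
        exact ContinuousLinearMap.le_opNorm _ _
    _ = ‖fderiv ℝ (u t) x‖ := by rw [he, mul_one, mul_one]

/-! ## §1 Door A0 «StrainRatioDoor» (forward face; PROVED in §6) -/

/-- door S38-A0 «StrainRatioDoor» (regularity criterion; FEEDING PARITY). `ν > 0`, `0 ≤ t₀ < T`, `l₀ ≥ 0`, `c < 1`,
`0 < δ < 1`, `(u,p)` in the S33 frame. HYPOTHESIS, charged at every `(1−δ)`-ALMOST MAXIMISER `(x,e)` of the strain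
form at times `t ∈ [t₀,T)` with `⟪∇u(t,x)e,e⟫ > l₀`: the strain feed is at most the fraction `c` of the Riccati
credit, `¼(|ω|² − ⟪ω,e⟫²) − ∇²p(e,e) ≤ c·⟪∇u e,e⟫²`. CONCLUSION: extension past `T` (indeed `Λ(t)` stays bounded:
`∂ₜq ≤ −(1−c)q² + o(1)q` at the charged points, constant barrier, then door Λ). No rate, no `(T−t)`-weight. -/
def StrainRatioDoor : Prop :=
  ∀ (ν T t₀ l₀ c δ : ℝ), 0 < ν → 0 ≤ t₀ → t₀ < T → 0 ≤ l₀ → c < 1 → 0 < δ → δ < 1 →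
    ∀ (u : ℝ → (EuclideanSpace ℝ (Fin 3)) → (EuclideanSpace ℝ (Fin 3)))
      (p : ℝ → (EuclideanSpace ℝ (Fin 3)) → ℝ),
      IsClassicalNSSolutionOn (Ico 0 T) ν 0 u p →
      (∀ T'' < T, HasBoundedSobolevNormsOn (Icc 0 T'') u) →
      (∀ t ∈ Ico t₀ T, ∀ (x e : EuclideanSpace ℝ (Fin 3)), IsStrainAlmostArgmax δ u t x e →
        l₀ < strainQuad u t x e → strainFeed u p t x e ≤ c * strainQuad u t x e ^ 2) →
      HasSobolevExtensionPast ν u T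

/-! ## §2 Doors A1 «StrainClockNoStretching» / «StrainClockLiouville» (ancient, rate-free) -/

/-- door S38-A1♮ «StrainClockNoStretching» (conditional Liouville, first half). THE ANCIENT FRAME (LEAD's
`ArgmaxDoorsAncient` binders + a gradient bound): `ν > 0`; `(u,p)` classical on every backward slab
`[s₁,s₂] ⊂ (−∞,0)`; `|u| ≤ U` and `‖∇u‖ ≤ L` on `(−∞,0) × ℝ³`. HYPOTHESIS (`c < 1`, `0 < δ < 1`), charged at every
`(1−δ)`-almost maximiser `(x,e)` of the strain form at times `s < 0` with `⟪∇u(s,x)e,e⟫ > 0`: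
`¼(|ω|² − ⟪ω,e⟫²) − ∇²p(e,e) ≤ c·⟪∇u e,e⟫²`. CONCLUSION: `⟪∇u(s,x)e,e⟫ ≤ 0` for ALL `s < 0`, `x`, unit `e` — no
stretching direction anywhere (the strain clock `d(1/Λ)/ds ≥ 1 − c` run from `s₁ → −∞`). -/
def StrainClockNoStretching : Prop :=
  ∀ (ν U L c δ : ℝ), 0 < ν → c < 1 → 0 < δ → δ < 1 →
    ∀ (u : ℝ → (EuclideanSpace ℝ (Fin 3)) → (EuclideanSpace ℝ (Fin 3)))
      (p : ℝ → (EuclideanSpace ℝ (Fin 3)) → ℝ),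
      (∀ s₁ s₂ : ℝ, s₁ < s₂ → s₂ < 0 → IsClassicalNSSolutionOn (Icc s₁ s₂) ν 0 u p) →
      (∀ s : ℝ, s < 0 → ∀ x : EuclideanSpace ℝ (Fin 3), ‖u s x‖ ≤ U) →
      (∀ s : ℝ, s < 0 → ∀ x : EuclideanSpace ℝ (Fin 3), ‖fderiv ℝ (u s) x‖ ≤ L) →
      (∀ s : ℝ, s < 0 → ∀ (x e : EuclideanSpace ℝ (Fin 3)), IsStrainAlmostArgmax δ u s x e →
        0 < strainQuad u s x e → strainFeed u p s x e ≤ c * strainQuad u s x e ^ 2) →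
      ∀ s : ℝ, s < 0 → ∀ (x e : EuclideanSpace ℝ (Fin 3)), ‖e‖ = 1 → strainQuad u s x e ≤ 0

/-- door S38-A1 «StrainClockLiouville» (conditional Liouville theorem for bounded ancient solutions). Same frame and
hypothesis as A1♮. CONCLUSION: `u(s,·)` is constant for every `s < 0` (A1♮ gives `S ≤ 0` as a form, `tr S = div u
= 0` forces `S ≡ 0`, and a bounded field with vanishing strain is constant — plate «RigidMotion»). -/
def StrainClockLiouville : Prop :=
  ∀ (ν U L c δ : ℝ), 0 < ν → c < 1 → 0 < δ → δ < 1 →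
    ∀ (u : ℝ → (EuclideanSpace ℝ (Fin 3)) → (EuclideanSpace ℝ (Fin 3)))
      (p : ℝ → (EuclideanSpace ℝ (Fin 3)) → ℝ),
      (∀ s₁ s₂ : ℝ, s₁ < s₂ → s₂ < 0 → IsClassicalNSSolutionOn (Icc s₁ s₂) ν 0 u p) →
      (∀ s : ℝ, s < 0 → ∀ x : EuclideanSpace ℝ (Fin 3), ‖u s x‖ ≤ U) →
      (∀ s : ℝ, s < 0 → ∀ x : EuclideanSpace ℝ (Fin 3), ‖fderiv ℝ (u s) x‖ ≤ L) →
      (∀ s : ℝ, s < 0 → ∀ (x e : EuclideanSpace ℝ (Fin 3)), IsStrainAlmostArgmax δ u s x e →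
        0 < strainQuad u s x e → strainFeed u p s x e ≤ c * strainQuad u s x e ^ 2) →
      ∀ s : ℝ, s < 0 → ∀ x y : EuclideanSpace ℝ (Fin 3), u s x = u s y

/-! ## §3 Doors A2 «TypeIAncientSubcriticalStrain» / «TypeIAncientStrainLaw» / «TypeIAncientStrainLiouville» -/

/-- door S38-A2♮ «TypeIAncientSubcriticalStrain» (first half of A2). THE TYPE-I ANCIENT FRAME: `ν > 0`; `(u,p)`
classical on every backward slab `[s₁,s₂] ⊂ (−∞,0)`; `|u| ≤ U`; Type-I gradient `‖∇u(s,x)‖ ≤ A/(−s)` (the class of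
KNSS blow-up limits of a Type-I singularity). HYPOTHESIS (`0 < y₀ < 1`, `c < y₀(1+y₀)`, `0 < δ < 1`) = door S37-H♭'s,
read on the ancient clock: at every `(1−δ)`-almost maximiser `(x,e)` of the strain form at times `s < 0` with
`(−s)⟪∇u(s,x)e,e⟫ > y₀`, the dimensionless feed obeys `(−s)²·(¼(|ω|² − ⟪ω,e⟫²) − ∇²p(e,e)) ≤ c`. CONCLUSION:
`(−s)⟪∇u(s,x)e,e⟫ ≤ y₀` for ALL `s < 0`, `x`, unit `e` (the S37 log barrier `(C₀ + κ log(−s))/(−s)` on `[s₀/ρ, s₀]`,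
`ρ = e^{−(A+1−y₀)/κ}`, `κ = (y₀²+y₀−c)/2`, tuned to land at `y₀/(−s₀)`). -/
def TypeIAncientSubcriticalStrain : Prop :=
  ∀ (ν U A y₀ c δ : ℝ), 0 < ν → 0 < y₀ → y₀ < 1 → c < y₀ * (1 + y₀) → 0 < δ → δ < 1 →
    ∀ (u : ℝ → (EuclideanSpace ℝ (Fin 3)) → (EuclideanSpace ℝ (Fin 3)))
      (p : ℝ → (EuclideanSpace ℝ (Fin 3)) → ℝ),
      (∀ s₁ s₂ : ℝ, s₁ < s₂ → s₂ < 0 → IsClassicalNSSolutionOn (Icc s₁ s₂) ν 0 u p) →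
      (∀ s : ℝ, s < 0 → ∀ x : EuclideanSpace ℝ (Fin 3), ‖u s x‖ ≤ U) →
      (∀ s : ℝ, s < 0 → ∀ x : EuclideanSpace ℝ (Fin 3), ‖fderiv ℝ (u s) x‖ ≤ A / (-s)) →
      (∀ s : ℝ, s < 0 → ∀ (x e : EuclideanSpace ℝ (Fin 3)), IsStrainAlmostArgmax δ u s x e →
        y₀ < (-s) * strainQuad u s x e → (-s) ^ 2 * strainFeed u p s x e ≤ c) →
      ∀ s : ℝ, s < 0 → ∀ (x e : EuclideanSpace ℝ (Fin 3)), ‖e‖ = 1 → (-s) * strainQuad u s x e ≤ y₀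

/-- door S38-A2 «TypeIAncientStrainLaw» (conditional Liouville: the strain face of LEAD's ancient argmax law). Same
frame and hypothesis as A2♮. CONCLUSION: `ω ≡ 0` on `(−∞,0) × ℝ³` (A2♮ gives `α − ν|∇ξ|² ≤ ⟪∇u ξ,ξ⟫ ≤ y₀/(−s)` at
EVERY point, in particular at the vorticity almost-argmaxima: `ArgmaxDoors.curl_eq_zero_of_ancient_typeI_of_almostArgmax_rate`
with `a := y₀ < 1`). -/
def TypeIAncientStrainLaw : Prop :=
  ∀ (ν U A y₀ c δ : ℝ), 0 < ν → 0 < y₀ → y₀ < 1 → c < y₀ * (1 + y₀) → 0 < δ → δ < 1 →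
    ∀ (u : ℝ → (EuclideanSpace ℝ (Fin 3)) → (EuclideanSpace ℝ (Fin 3)))
      (p : ℝ → (EuclideanSpace ℝ (Fin 3)) → ℝ),
      (∀ s₁ s₂ : ℝ, s₁ < s₂ → s₂ < 0 → IsClassicalNSSolutionOn (Icc s₁ s₂) ν 0 u p) →
      (∀ s : ℝ, s < 0 → ∀ x : EuclideanSpace ℝ (Fin 3), ‖u s x‖ ≤ U) →
      (∀ s : ℝ, s < 0 → ∀ x : EuclideanSpace ℝ (Fin 3), ‖fderiv ℝ (u s) x‖ ≤ A / (-s)) →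
      (∀ s : ℝ, s < 0 → ∀ (x e : EuclideanSpace ℝ (Fin 3)), IsStrainAlmostArgmax δ u s x e →
        y₀ < (-s) * strainQuad u s x e → (-s) ^ 2 * strainFeed u p s x e ≤ c) →
      ∀ s : ℝ, s < 0 → ∀ x : EuclideanSpace ℝ (Fin 3), curl (u s) x = 0

/-- door S38-A2♯ «TypeIAncientStrainLiouville»: same frame and hypothesis; CONCLUSION `u(s,·)` constant for every
`s < 0` (`curl u = 0`, `div u = 0`, bounded: `eq_of_curl_eq_zero_of_isDivFree_of_bounded`, via LEAD's
`velocity_const_of_ancient_typeI_of_almostArgmax_rate`). -/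
def TypeIAncientStrainLiouville : Prop :=
  ∀ (ν U A y₀ c δ : ℝ), 0 < ν → 0 < y₀ → y₀ < 1 → c < y₀ * (1 + y₀) → 0 < δ → δ < 1 →
    ∀ (u : ℝ → (EuclideanSpace ℝ (Fin 3)) → (EuclideanSpace ℝ (Fin 3)))
      (p : ℝ → (EuclideanSpace ℝ (Fin 3)) → ℝ),
      (∀ s₁ s₂ : ℝ, s₁ < s₂ → s₂ < 0 → IsClassicalNSSolutionOn (Icc s₁ s₂) ν 0 u p) →
      (∀ s : ℝ, s < 0 → ∀ x : EuclideanSpace ℝ (Fin 3), ‖u s x‖ ≤ U) →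
      (∀ s : ℝ, s < 0 → ∀ x : EuclideanSpace ℝ (Fin 3), ‖fderiv ℝ (u s) x‖ ≤ A / (-s)) →
      (∀ s : ℝ, s < 0 → ∀ (x e : EuclideanSpace ℝ (Fin 3)), IsStrainAlmostArgmax δ u s x e →
        y₀ < (-s) * strainQuad u s x e → (-s) ^ 2 * strainFeed u p s x e ≤ c) →
      ∀ s : ℝ, s < 0 → ∀ x y : EuclideanSpace ℝ (Fin 3), u s x = u s y

/-! ## §4 Plates -/

/-- plate F_S∘ «StrainFrameOn» (S; the momentum equation differentiated in space, on a CLOSED time slab). For a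
classical solution on `[s₁,s₂]` (`s₁ < s₂`), every `s ∈ [s₁,s₂]`, `x`, `e`:
`∂ₜ(∇u e)(s,x) + D((u·∇)u)(x) e = ν D(Δu)(x) e − D(∇p)(x) e`, `∂ₜ = timeDerivWithin [s₁,s₂]`. PROVED below
(`strainFrameOn_holds`, verbatim port of `strainFrame_holds`). -/
def StrainFrameOn : Prop :=
  ∀ (ν s₁ s₂ : ℝ), s₁ < s₂ →
    ∀ (u : ℝ → (EuclideanSpace ℝ (Fin 3)) → (EuclideanSpace ℝ (Fin 3)))
      (p : ℝ → (EuclideanSpace ℝ (Fin 3)) → ℝ),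
      IsClassicalNSSolutionOn (Icc s₁ s₂) ν 0 u p →
      ∀ s ∈ Icc s₁ s₂, ∀ (x e : EuclideanSpace ℝ (Fin 3)),
        timeDerivWithin (Icc s₁ s₂) (fun r y => fderiv ℝ (u r) y e) s x + fderiv ℝ (convect (u s) (u s)) x e
          = ν • fderiv ℝ (Δ (u s)) x e - fderiv ℝ (gradient (p s)) x e

/-- plate E2_S∘ «StrainThresholdOn» (S; CLOSED BY NAME: the binders are VERBATIM those of LEAD ns-s30-p1 g3's
p661976 `ArgmaxDoors.strainThresholdAncient` — the device p657155 `ArgmaxDoors.rayleigh_le_supersolution_of_almostArgmax_growth`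
instantiated on a CLOSED SLAB `[s₁,s₂]` with a BOUNDED GRADIENT (∃-hypothesis) in place of the Sobolev class).
`0 < δ < 1`; allowance `η(ε) → 0` (`ε ↓ 0`); `B > 0` continuous with `φB ≤ B'` within `[s₁,s₂]`. IF for every
`0 < ε ≤ 1`, every `s ∈ (s₁,s₂]` and every `(x,e)`, `|e| = 1`, that is a PENALISED maximiser, a `(1−δ)`-almost
maximiser and has `⟪∇u e,e⟫ > B(s)`: `⟪∂ₜ(∇u e),e⟫ ≤ (φ(s) + η(ε))⟪∇u e,e⟫` — THEN `⟪∇u(s₁,·)e,e⟫ ≤ B(s₁)`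
propagates along the slab (`strainThresholdOn_holds := strainThresholdAncient`, §6). -/
def StrainThresholdOn : Prop :=
  ∀ (ν s₁ s₂ δ : ℝ) (η : ℝ → ℝ), 0 < ν → s₁ < s₂ → 0 < δ → δ < 1 → Tendsto η (𝓝[>] 0) (𝓝 0) →
    ∀ (u : ℝ → (EuclideanSpace ℝ (Fin 3)) → (EuclideanSpace ℝ (Fin 3)))
      (p : ℝ → (EuclideanSpace ℝ (Fin 3)) → ℝ),
      IsClassicalNSSolutionOn (Icc s₁ s₂) ν 0 u p →
      (∃ K : ℝ, ∀ s ∈ Icc s₁ s₂, ∀ x : EuclideanSpace ℝ (Fin 3), ‖fderiv ℝ (u s) x‖ ≤ K) →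
      ∀ (B B' φ : ℝ → ℝ), ContinuousOn B (Icc s₁ s₂) → (∀ s ∈ Icc s₁ s₂, 0 < B s) →
        (∀ s ∈ Icc s₁ s₂, HasDerivWithinAt B (B' s) (Icc s₁ s₂) s) →
        (∀ s ∈ Icc s₁ s₂, φ s * B s ≤ B' s) →
        (∀ ε : ℝ, 0 < ε → ε ≤ 1 → ∀ s ∈ Ioc s₁ s₂, ∀ (x e : EuclideanSpace ℝ (Fin 3)), ‖e‖ = 1 →
          (∀ (y e' : EuclideanSpace ℝ (Fin 3)), ‖e'‖ = 1 →
            (1 + ε * ‖y‖ ^ 2)⁻¹ * strainQuad u s y e' ≤ (1 + ε * ‖x‖ ^ 2)⁻¹ * strainQuad u s x e) →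
          (∀ (y e' : EuclideanSpace ℝ (Fin 3)), ‖e'‖ = 1 → (1 - δ) * strainQuad u s y e' ≤ strainQuad u s x e) →
          B s < strainQuad u s x e →
          strainRateOn (Icc s₁ s₂) u s x e ≤ (φ s + η ε) * strainQuad u s x e) →
        (∀ (x e : EuclideanSpace ℝ (Fin 3)), ‖e‖ = 1 → strainQuad u s₁ x e ≤ B s₁) →
        ∀ s ∈ Icc s₁ s₂, ∀ (x e : EuclideanSpace ℝ (Fin 3)), ‖e‖ = 1 → strainQuad u s x e ≤ B s

/-- plate «RigidMotion» (S; bounded Killing fields are constant — the text shape of ns-sfl-p1 g5's LANDED p663033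
`ArgmaxDoors.eq_of_strain_eq_zero_of_bounded`, `Theorems/StrainClockRigid.lean`; CLOSED BY NAME in §6, `rigidMotion_holds`).
A `C²` field `V` on `ℝ³` whose strain form vanishes identically, `⟪∇V(x) e, e⟫ = 0` for all `x, e`, and which is
bounded, is constant. (Polarisation ⇒ `∇V(x)` skew; Killing braid ⇒ `D²V ≡ 0` ⇒ `V` affine with skew linear part;
bounded ⇒ constant.) The passage from door A1♮'s `⟪∇u e,e⟫ ≤ 0` (unit `e`) to `= 0` (all `e`) is the TRACE
STEP `tr ∇u = div u = 0`, proved here (`inner_fderiv_apply_self_eq_zero_of_nonpos_of_isDivFree`, §5). -/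
def RigidMotion : Prop :=
  ∀ (V : (EuclideanSpace ℝ (Fin 3)) → (EuclideanSpace ℝ (Fin 3))), ContDiff ℝ 2 V →
    (∀ (x e : EuclideanSpace ℝ (Fin 3)), ⟪fderiv ℝ V x e, e⟫ = 0) →
    (∃ M : ℝ, ∀ x, ‖V x‖ ≤ M) → ∀ x y : EuclideanSpace ℝ (Fin 3), V x = V y

end Summit.NavierStokesRegularity.NavierStokesRegularity.Theorems.StrainDoors

end
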